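import Mathlib
import HarnessLib
import HarnessLib.Audit
import Summits.AtomisticToContinuum.Statement
import Literature.Geometry.DiscreteGeometry.KissingPatterns
import Literature.MathematicalPhysics.StatisticalMechanics.LennardJonesClusters
import Literature.MathematicalPhysics.StatisticalMechanics.MuGSC
import Literature.MathematicalPhysics.StatisticalMechanics.LennardJonesThermodynamicLimitProofs
import Summits.AtomisticToContinuum.Crystallization.Theses.HullMinimality
import Summits.AtomisticToContinuum.Crystallization.Theses.RecurrentDefectTrichotomy
import Summits.AtomisticToContinuum.Crystallization.Theses.MuStablePoreSplit
import Summits.AtomisticToContinuum.Crystallization.Theses.CoexistenceDensityWindow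
import Summits.AtomisticToContinuum.Crystallization.Theorems.ReggeStarCoercivityDefectFreeCrystallizesHullCriterion
import Summits.AtomisticToContinuum.Crystallization.Theorems.PhononSlackCertificatesWindowOptimality
import HarnessLib.Audit.Status.Attr

/-!
Route: CompactDefectReducibility

# Route CompactDefectReducibility — Mu-stable LJ limits have no removable defects; isolated compact
defects are reducible by local grand-canonical surgery, the residual is defects accompanied at every
scale

It suffices to show X = RedMu ∧ A ∧ S ∧ P1 ∧ D⁺ ∧ D⁻ ∧ R ∧ U (decomp-a2c cell, lens 4 «minimal
counterexample / extremal reduction», generation 4: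
child node of route CoexistenceDensityWindow refining its declared residual D⁰ =
IsochoricAperiodicDefectLimitWindows stmt-27257). RedMu, A, S,
P1, D⁺, D⁻ are the ancestors' items shared VERBATIM (stmt-26048, 24668, 24669, 26047, 27258, 27259).
D⁰'s world — x a sequence of LJ ground states,
Y ∋ 0 a two-way local limit of x, uniformly recurrent, uniformly discrete, a Sütő μGSC at the
coexistence potential e* = lim E(N)/N, not uniformly
gapped-twelve at any scale a ∈ [47/50,1], solid (covering radius < 9/10), aperiodic, isochoric (cube
counts in ((5/4)ℓ³, 2ℓ³)) — is cut by the
ISOLATION PROFILE of its defects, with the lineage's per-site clean predicate (gapped-twelve + shell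
close to fcc/hcp) at two tolerances as a
hysteresis (TIGHT (1/50, 1/5) for collars, LOOSE (1/10, 2/5) for cores): R =
IsolatedDefectLimitWindows (some loose defect sits in a ball B̄(c,K)
whose proportional collar (K, 4K+6] is entirely tight-clean ⟹ windows) and U =
AccompaniedDefectLimitWindows (no such isolated defect at any scale
or radius — every defect is accompanied at all scales, i.e. the defect set is extended ⟹ windows;
the declared residual). ISO/¬ISO is excluded
middle, so D⁰ ⟺ R ∧ U unconditionally (node file: `isochoricAperiodic_iff_pieces`, both directions
in the kernel) and each piece is implied by
`Crystallization` (`isolated_of_crystallization`, `accompanied_of_crystallization`): the node is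
EXACT and every open piece weaker.
Lean: `Summit.AtomisticToContinuum.Crystallization.Theses.HullMinimality.PeriodicWindows`

## Assembly
Pure logic plus the parent's landed deciding theorem: `CoexistenceDensityWindow.closes hRed hA hS
hP1 hD⁺ hD⁻ D⁰` with D⁰ assembled from the two
new pieces by excluded middle on ISO(Y) (`isochoricAperiodic_of_pieces hR hU` in the node file;
inlined `by_cases` in glue.lean). Deciding theorem
`closes` in glue.lean (8 binders = 7 cruxes + the support RedMu, all used); kernel-checked in the
node file (0 sorry, axioms propext /
Classical.choice / Quot.sound).

Rationale: WHY THIS LINE. This is the reducibility step of a minimal-counterexample argument, the half that the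
lens had not yet used: generations 0–3 built the extremal
object (a Zorn-minimal recurrent local limit, μ-pinned at coexistence arXiv:math-ph/0508004, solid,
aperiodic, isochoric); generation 4 asks
what a counterexample CANNOT contain. μ-stability (`IsMuGSC`: no finite removal / insertion /
exchange lowers U − e*·#) makes every finite patch
of Y an in-situ grand-energy minimiser among ALL refills of its cavity; when the cavity wall is a
tight-clean Barlow crystal (two-pattern rigidity,
`HalesDSP_layerPackings_holds`, item 24072) the crystalline continuation of the wall is an
admissible refill, so a loose defect isolated inside a
clean collar must win a FINITE, certified cavity-landscape competition at μ = e* — and at the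
first-shell scale it loses by elementary surgery
(vacancy: one-point insertion gains ≈ |e*| = 0.72; interstitial: one-point removal, octahedral-hole
bonds at 0.69 cost +6.0 each; displaced
atom: one-point exchange — the rung proved in the node file). The imported dictionary is the
lattice-gas one of Holsztynski–Slawny
[corpus:paper:doi-10-1007-bf01609493 p.3] (Peierls condition ⇒ a ground state contains no finite
contour): contour ↦ loose-defective core
inside a tight-clean collar, Peierls constant ↦ the cavity margin δ₀(K), m-potential positivity ↦
μ-stability at e* plus the convexity basin of
fcc/hcp under LJ (certified phonon positivity arXiv:2506.22614, local rigidity FlatleyTheil2015);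
and the numerical-analysis one of
Ehrlacher–Ortner–Shapeev arXiv:1306.5334 (cell problems for point defects in a crystalline far field
are well posed with algebraically decaying
correctors — the object δ₀(K) is exactly their defect-formation energy at fixed chemical potential).
The margin is DILUTION-INDEPENDENT, which
is why the lineage's μ-pinned limit object is the right arena: lens-1 records that global
certificate floors along its dilute rung vanish like
E_vac·(a/L₀)³ and `Cruxes/TwoShellDefectGap/Dilution.lean` proves dilute restrictions of global
linear pricing are costume; local surgery sees an
isolated defect with an O(1) margin however sparse defects are. What is left (U) is the unavoidable
set in normal form: defects accompanied at
every scale = extended defect networks, whose tools are the Γ-convergence lower bounds for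
dislocation / grain-boundary energies
(arXiv:1608.06155, Conti–Garroni–Ortiz line tension [corpus:paper:arxiv-2207.01526 p.32]) — 3-D
atomistic versions not yet in print — and,
for uncharted aperiodic bulk, nothing known (barriers TetrahedralFrustration / IcosahedralClusters /
AperiodicTilingGroundStates ring it).

RANKED CRUXES. #2 IsolatedDefectLimitWindows (crux) — D⁰'s hypotheses (coexistence e = lim E(N)/N
with e ≤ E(N)/N; x LJ ground states; Y ∋ 0 a two-way local limit of x, uniformly recurrent,
uniformly discrete, IsMuGSC lennardJones e Y; not uniformly gapped-twelve at any scale a ∈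
[47/50,1]; covering radius < 9/10; Y not the point set of a PeriodicConfiguration 3; beyond some
scale every half-open cube of side ℓ holds strictly between (5/4)ℓ³ and 2ℓ³ points) plus ISO(Y): at
some scale a ∈ [47/50,1] and radius K > 0 some ball B̄(c,K) contains a site of Y that is NOT
Clean(1/10, 2/5; a) (twelve points of Y in [0.9a, 1.1a], all others beyond 1.26a, rescaled shell
2/5-close to the fcc or hcp kissing pattern) while EVERY site of Y at distance in (K, 4K+6] from c
IS Clean(1/50, 1/5; a) ⟹ x has periodic windows. The REDUCIBILITY piece: a μ-stable configuration
has no removable (compactly isolated) defect. [deps: RecurrentMuStableLimit] [difficulty: L] (why it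
might fail: only via K-uniformity: a large coherent inclusion of an exactly degenerate zero-slack
phase with zero interface tension against the Barlow collar would give δ₀(K) → 0; at each bounded K
it is a finite certified cavity-landscape computation.) [arXiv:math-ph/0508004,
paper:doi-10-1007-bf01609493, arXiv:1306.5334, arXiv:2506.22614, FlatleyTheil2015, Hales2012,
stmt-AtomisticToContinuum-27257, stmt-AtomisticToContinuum-24072]
#3 AccompaniedDefectLimitWindows (crux) — D⁰'s hypotheses plus ¬ISO(Y): at every scale a ∈
[47/50,1], for every loose-defective site y (not Clean(1/10,2/5;a)) and every radius K > 0, the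
collar of sites at distance in (K, 4K+6] from any centre c with dist(y,c) ≤ K contains a site that
is not Clean(1/50,1/5;a) — every defect is ACCOMPANIED AT EVERY SCALE, i.e. the defect set of Y is
extended (syndetic line / wall networks in a charted matrix, or uncharted defective bulk) ⟹ x has
periodic windows. DECLARED RESIDUAL of the node («unavoidable = extended defects at coexistence»).
[deps: RecurrentMuStableLimit] [difficulty: XL] (why it might fail: an aperiodic, recurrent, solid,
isochoric configuration μ-stable at e* whose defects are all extended — an aperiodic screened
dislocation/GB network or aperiodic tetrahedrally-close-packed bulk of energy density exactly e*:
then U is the conjecture on that sequence.) [arXiv:1306.5334, arXiv:1608.06155,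
paper:arxiv-2207.01526, FlatleyTheil2015, Theil2006, BlancLewin2015,
stmt-AtomisticToContinuum-27257, stmt-AtomisticToContinuum-23839, stmt-AtomisticToContinuum-27483]
#4 OverdenseDefectLimitWindows (crux) — SHARED ITEM stmt-AtomisticToContinuum-27258 of route
CoexistenceDensityWindow, verbatim: P2's hypotheses plus OVERDENSE (for every ℓ₀ some half-open cube
of side ℓ ≥ ℓ₀ with lower corner c holds at least 2ℓ³ points of Y, i.e. ≥ 1.30 ρ_hcp) ⟹ x has
periodic windows. Attack: periodise a dense cube, Cohn–Kumar LP with density term vs zero-slack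
μ-removal pinning and certified e(hcp); elementary Kepler/Kossel fallback from density ≈ 3. [deps:
RecurrentMuStableLimit] [difficulty: M] (why it might fail: only technically: no two-point
certificate f ≤ V_LJ, f̂ ≥ 0 with (2·f̂(0) − f(0))/2 > −0.7175 may exist if the 3D LP duality gap
for the r⁻¹² core at density 2 exceeds the +0.4 physical excess (Li 2022-type gap).)
[arXiv:1902.05438, arXiv:1603.05202, arXiv:2206.09876, arXiv:math-ph/0508004, BlancLewin2015,
stmt-AtomisticToContinuum-26046, stmt-AtomisticToContinuum-25861]
#5 UnderdenseDefectLimitWindows (crux) — SHARED ITEM stmt-AtomisticToContinuum-27259 of route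
CoexistenceDensityWindow, verbatim: P2's hypotheses plus UNDERDENSE (for every ℓ₀ some half-open
cube of side ℓ ≥ ℓ₀ holds at most (5/4)ℓ³ points of Y, i.e. ≤ 0.81 ρ_hcp) ⟹ x has periodic windows.
Census j338194 (I-D(b)): the admissible relaxed floor at ρ ≤ 5/4 is uniformly dilated hcp/fcc at ρ =
5/4, +0.085 above e_hcp; missing: density → first-shell-deficit transfer, then the
coordination-capped LP floor(11) = e_hcp + 0.0087. [deps: RecurrentMuStableLimit] [difficulty: L]
(why it might fail: it cannot be false without Crystallization failing; it may resist because no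
Flyspeck-type local inequality turns fat Voronoi cells of a soft-potential configuration into a
certified per-site energy deficit.) [Hales2005, Theil2006, BlancLewin2015, arXiv:1902.05438,
stmt-AtomisticToContinuum-26046, stmt-AtomisticToContinuum-25861]
#6 PorousDefectLimitWindows (crux) — SHARED ITEM stmt-AtomisticToContinuum-26047 of route
MuStablePoreSplit, verbatim: the same normal form but POROUS (some point of space with no point of Y
within 9/10) ⟹ periodic windows (cohesion / no-foam; vacancy-type pores already excluded by the
Kossel sandwich). [deps: RecurrentMuStableLimit] [difficulty: L] (why it might fail: a recurrent
μ-stable LJ sponge with energy density exactly e*: loose pores of radius in (1, 3/2) pass the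
one-point insertion test; excluding syndetic loose pores needs positive 3D surface tension (open).)
[arXiv:math-ph/0508004, HeitmannRadin1980, Theil2006, BlancLewin2015,
stmt-AtomisticToContinuum-24040, stmt-AtomisticToContinuum-24667]
#7 CleanRecurrentLimitWindows (crux) — SHARED ITEM stmt-AtomisticToContinuum-24668 of route
RecurrentDefectTrichotomy, verbatim: a recurrent local limit Y ∋ 0 of x all of whose shells at some
scale a ∈ [47/50,1] are gapped-twelve and 1/5-close to fcc or hcp forces periodic windows for x.
[deps: RecurrentMuStableLimit] [difficulty: L] (why it might fail: residual in-layer strain no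
translate-limit removes because layered coercivity fails for some relaxed polytype (soft shear
branch), or non-parallel twin junctions compatible with all-clean shells at tolerance 1/5.)
[Hales2012, FlatleyTheil2015, BlancLewin2015, stmt-AtomisticToContinuum-15932,
stmt-AtomisticToContinuum-11779]
#8 TornCappedRecurrentLimitWindows (crux) — SHARED ITEM stmt-AtomisticToContinuum-24669 of route
RecurrentDefectTrichotomy, verbatim: a recurrent local limit Y ∋ 0 of x all gapped-twelve at some
scale but at no scale all fcc/hcp-close forces periodic windows for x. [deps:
RecurrentMuStableLimit] [difficulty: L] (why it might fail: an all-gapped-twelve recurrent TORN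
crystal (torn icosahedral / bicuboctahedral shells sharing voids) with energy density e*: S stays
true but its geometric attack dies.) [FlatleyTheil2015, Hales2012, BoroczkySzabo2015,
stmt-AtomisticToContinuum-18069, stmt-AtomisticToContinuum-18071]
#9 RecurrentMuStableLimit (support) — SHARED ITEM stmt-AtomisticToContinuum-26048 of route
MuStablePoreSplit, verbatim: for the coexistence potential e, every sequence of LJ ground states has
a local limit Y ∋ 0, uniformly recurrent along particles, uniformly discrete and a μGSC of
lennardJones at μ = e (stmt-13684 → stmt-13685 → minimal hull point). [difficulty: provable-now]
[arXiv:math-ph/0508004, BlancLewin2015, stmt-AtomisticToContinuum-13684,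
stmt-AtomisticToContinuum-13685]

TWO-LAYER PLAN. Birth skeletons (BC3, folder bc/*_birth.lean, rc 0, sorries = stubs). R ⇐
stub_smallCores (ISO with K ≤ 5/4: the core is a site and its first
shell; refills split by particle number — vacancy type by one-point insertion, crowding by one-point
removal, displacement by one-point exchange
(kernel rung `isolatedDefect_rung_onePointExchange`), wrong 13-atom topology by the certified
13-site cavity landscape at μ = e*; M, ATTACKABLE now,
instrument ASK I-R1) ∧ stub_largeCores (ISO with K > 5/4: crystalline-continuation competitor from
the collar chart + certified cavity landscapes per
K + K-uniform margin from the convexity basin; L) → R (excluded middle on K ≤ 5/4, kernel-checked).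
U ⇐ stub_chartedNetworks (¬ISO and tight-clean
sites R₀-dense: screened dislocation / disclination line networks and wall foams with clean grains;
tool: positive excess per unit volume of
extended defect content vs zero slack e(Y) = e* — 3-D atomistic Read–Shockley / logarithmic
line-energy lower bounds, IDEA-NEEDED) ∧
stub_unchartedBulk (¬ISO and clean sites not relatively dense: aperiodic defective bulk;
BARRIER-ringed) → U (excluded middle, kernel-checked).
No second-layer items are filed now; the stubs are registered lines, not route items.

KILL CRITERIA. No refutation of R, U, D⁺, D⁻, P1, A or S is possible without refuting
`Crystallization` (each is a kernel consequence): a refutation of any piece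
closes the SUMMIT conjunct negatively and is banked as such. RedMu is unconditional. The LINE (not
the pieces) dies if instrument ASK I-R1 finds a
cavity radius K at which some refill containing a loose-defective site ties the crystalline refill
at μ = e* inside a tight-clean hcp or fcc
collar (δ₀(K) ≤ numerical error) — then reducibility fails at finite K, R is in substance as hard as
U, and the isolation cut bought nothing:
retire R's attack to the K at which δ₀ was last certified positive and hand the rest to U. The
residual U is retired to lens-2's
`GenericBulkCase`/`CoarseDensityTrichotomy` staffing if ASK I-R2 reports an extended-defect family
with excess per unit volume → 0 at fixed density
window (other than the clean planar faults), because then the normal form ¬ISO has a concrete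
zero-slack inhabitant candidate.

NOT DECOMPOSED YET. Inside R: the collar-chart lemma (a tight-clean thick spherical shell of Y is,
site by site, within C/50 of an isometric image of a Barlow
stacking; two-pattern rigidity + simple connectivity of the shell), the admissibility of the
crystalline continuation as a refill (hard-core
distance 1/3 automatic, finite), the certified cavity landscapes δ₀(K) for K ∈ {5/4, 7/4, 9/4, 3}
(interval arithmetic over refills with free
particle number — finite-dimensional but not small), and the K-uniform margin (convexity basin of F*
from certified phonons: interior strain
of the in-basin equilibrium ≤ C × collar strain). Inside U: everything (the unavoidable set: 3-D
atomistic lower bounds for dislocation-network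
and grain-boundary-foam energy densities at zero stress; aperiodic TCP bulk — no tool known). The
two-layer stubs above are the registered plan.

CHEAPEST FALSIFIER. Lookup + kernel, run: (i) the one-point tests at the first-shell scale — vacancy
(insertion gains |e*| ≈ 0.72 ≫ relaxation ≈ 0.05), octahedral
interstitial (removal gains ≈ 6 × 6.0 − 0.72), displaced atom (exchange; PROVED as the kernel rung
`isolatedDefect_rung_onePointExchange`): all
three reducible with margins two orders of magnitude above tolerance effects — the line survives its
cheapest check; (ii) census j337726: a lone
icosahedral 13-shell embedded in fcc/hcp is NOT metastable under tree LJ (relaxes back to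
cuboctahedral/anticuboctahedral) — the k = 13
wrong-topology refill has no basin of its own at K = 5/4, qualitative support for δ₀(5/4) > 0; (iii)
census j337583: every PERIODIC
tetrahedrally-close-packed competitor sits ≥ +0.046 above e_hcp and is discharged anyway by the
parent's free periodic case. Next cheapest: ASK
I-R1 (cavity-refill landscapes δ₀(K), K ∈ {5/4, 7/4, 9/4, 3}, hcp and fcc collars, free particle
number) filed to decomp-a2c-census-1 with this node.

NUMBERS. Tree units (V = r⁻¹²/12 − r⁻⁶/6, minimum −1/12 at r = 1; standard LJ energies ÷ 12): a_hcp
= 0.97128, ρ_hcp = 1.5434, e* ≤ e_hcp = −0.7175893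
(j337583); per-site pair sum in hcp S = 2e_hcp = −1.4352; unrelaxed vacancy formation at μ = e*: −S
+ e* = +0.7176 (relaxation lowers it by
≈ 0.05); octahedral hole at a/√2 = 0.687 from six sites, V(0.687) = +5.95 per bond; harmonic on-site
energy of a displaced hcp site ≈ ½·V″(1)·Σ_j (u·e_j)² = 12|u|² (V″(1) = 13 − 7 = 6, twelve bonds,
V′(1) = 0), so a
displacement of 0.1 costs ≈ 0.12 ≫ 0; tolerances: TIGHT radial 1/50 (distances in
[0.98a, 1.02a], gap to 1.26a), shell 1/5; LOOSE radial 1/10, shell 2/5; collar (K, 4K+6] ⊇ a shell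
of thickness ≥ 3K+6 ≥ 6 > 4.7 = the two-shell
radius at which two-pattern rigidity charts a Barlow stacking; LJ minimal distance 1/3
(`LennardJonesMinimalDistance_holds`); window (5/4, 2) =
(0.81, 1.30)·ρ_hcp inherited.

DEFINITION REQUESTS. None: both new pieces are closed Props over existing declarations (`IsMuGSC`,
`UniformlyDiscrete`, `PeriodicConfiguration`, `Set.ncard`,
`ShellCloseTo`, `fccKissingPattern`, `hcpKissingPattern`); the clean predicates are inlined verbatim
from item 24668 at the two tolerances.

Novelty: Searches (2026-08-30): lit search --hybrid "vacancy interstitial formation energy Lennard-Jones fcc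
crystal relaxation" (8 books: Cai–Nix 2016 pp.135–137 vacancy formation/relaxation volume,
Allnatt–Lidiard 1993, Kaxiras 2003 — metals data, no μ-stability statement); lit search --source
local '"Peierls condition" ground state' (8 docs: [corpus:paper:doi-10-1007-bf01609493 p.3]
Holsztynski–Slawny 1978 = the lattice prototype «Peierls condition ⇒ no finite contour in a ground
state»; Friedli–Velenik 2017 pp.363,411; Pirogov–Sinai contour papers arXiv:0708.0067,
math-ph/0611038); lit search "Lauteri Luckhaus energy estimate dislocation configurations Cosserat"
/ "line-tension approximation dilute limit linear-elastic dislocations" / "Ehrlacher Ortner Shapeev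
boundary conditions crystal defect atomistic" (local hits only through citing papers:
[corpus:paper:arxiv-2207.01526 p.32–33], [corpus:paper:arxiv-1409.6084 p.17],
[corpus:paper:arxiv-1811.08741 p.10]; OpenAlex/S2 in HTTP-429 cool-down, not dialled); lit galaxy
search "Peierls condition" --star all (16 rows: [galaxy:panama:359188114964507] Friedli–Velenik Ch.
7, [galaxy:panama:205952271777837] Bricmont, [galaxy:pdf:5726398809782183900] Pirogov–Sinai contours
arXiv:0708.0067, [galaxy:pdf:-8202872698370598360] Bovier–Zahradník — all LATTICE; no
continuum-particle reducibility statement); lit galaxy search "Peierls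
condition|Holsztynski|m-potential" --star all (OR-needle, 20 junk rows — null); lit search --hybrid
"crystallizati  [refs: 0708.0067, 1306.5334, paper:doi-10-1007-bf01609493, paper:arxiv-2207.01526, paper:arxiv-1409.6084, paper:arxiv-1811.08741, paper:arxiv-2107.14020, paper:arxiv-2506.22614]

Barriers (technique_class: mu-surgery, reducibility, cavity-certificates): - technique_class: mu-surgery, reducibility, cavity-certificates, defect-rigidity
- Literature.Barriers.AtomisticToContinuum.TetrahedralFrustration: R never prices a shell in vacuum
— the competition is IN SITU inside a tight-clean Barlow collar at μ = e*, where the locally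
preferred icosahedral 13-cluster pays ≈ 84 misfit bonds (census j337726: not even metastable when
embedded); its periodic exhibits (A15, σ, β-Mn, Laves) are discharged in kernel by the parent's free
periodic case; its aperiodic bulk exhibits ring U (declared residual) honestly.
- Literature.Barriers.AtomisticToContinuum.IcosahedralClusters: idem — single-shell vacuum prices
are not used; an icosahedral core inside a clean collar is exactly R's k = 13 refill and loses in
situ; icosahedral order filling space aperiodically is U's enemy (residual).
- Literature.Barriers.AtomisticToContinuum.FccPolarTriplesUnlocking:
(Kusner–Kusner–Lagarias–Shlosman) hard-sphere kissing shells unjam with six moving balls; R's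
first-shell rung uses the LJ convexity basin (certified phonon/Born stability j337717,
arXiv:2506.22614), under which the unlocking path stretches contacts and costs energy — outside the
class (kissing geometry alone); the collar chart uses two-pattern rigidity on ≥ 2 shells (item
24072), not one-shell capping.
- Literature.Barriers.AtomisticToContinuum.FlexibleKissingArrangements: inherited placement for A/S
(Hales gap); R/U infer nothing from one shell — Clean requires the shell to be ALREADY 1/5-close

sub-problem: Crystallization · status: draft · opened planner-decomp-a2c-lens-4-g4-0 2026-08-30T05:10:55Z · rev 1 · ledger route-AtomisticToContinuum-CompactDefectReducibility
GENERATED by the gate from the ledger (D-0016/17). Provers cite these decls: `theorem foo : Summit.AtomisticToContinuum.Crystallization.Theses.CompactDefectReducibility.<Decl> := …` in Summits/AtomisticToContinuum/Crystallization/Theorems/<Name>.lean.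
-/

namespace Summit.AtomisticToContinuum.Crystallization.Theses.CompactDefectReducibility

open scoped BigOperators Topology Manifold Classical MeasureTheory ProbabilityTheory Matrix InnerProductSpace ComplexConjugate ContinuousMap
open Filter Set Function TopologicalSpace MeasureTheory

attribute [summit_statement] _root_.Crystallization

/-- item stmt-AtomisticToContinuum-28348 · crux · rank 2 · open · by planner
why it might fail: only via K-uniformity: a large coherent inclusion of an exactly degenerate zero-slack phase with zero interface tension against the Barlow collar would give δ₀(K) → 0; at each bounded K it is a finite certified cavity-landscape computation.
sources: arXiv:math-ph/0508004, paper:doi-10-1007-bf01609493, arXiv:1306.5334, arXiv:2506.22614, FlatleyTheil2015, Hales2012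
[crux] D⁰'s hypotheses (coexistence e = lim E(N)/N with e ≤ E(N)/N; x LJ ground states; Y ∋ 0 a
two-way local limit of x, uniformly recurrent, uniformly discrete, IsMuGSC lennardJones e Y; not
uniformly gapped-twelve at any scale a ∈ [47/50,1]; covering radius < 9/10; Y not the point set of a
PeriodicConfiguration 3; beyond some scale every half-open cube of side ℓ holds strictly between
(5/4)ℓ³ and 2ℓ³ points) plus ISO(Y): at some scale a ∈ [47/50,1] and radius K > 0 some ball B̄(c,K)
contains a site of Y that is NOT Clean(1/10, 2/5; a) (twelve points of Y in [0.9a, 1.1a], all others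
beyond 1.26a, rescaled shell 2/5-close to the fcc or hcp kissing pattern) while EVERY site of Y at
distance in (K, 4K+6] from c IS Clean(1/50, 1/5; a) ⟹ x has periodic windows. The REDUCIBILITY
piece: a μ-stable configuration has no removable (compactly isolated) defect. [deps:
RecurrentMuStableLimit] [difficulty: L] -/
@[route_item "route-AtomisticToContinuum-CompactDefectReducibility", crux]
def IsolatedDefectLimitWindows : Prop :=
  ∀ e : ℝ, Filter.Tendsto (fun N : ℕ => Literature.MathematicalPhysics.StatisticalMechanics.groundStateEnergy Literature.MathematicalPhysics.StatisticalMechanics.lennardJones 3 N / N) Filter.atTop (nhds e) → (∀ N : ℕ, 0 < N → e ≤ Literature.MathematicalPhysics.StatisticalMechanics.groundStateEnergy Literature.MathematicalPhysics.StatisticalMechanics.lennardJones 3 N / N) → ∀ x : (N : ℕ) → (Fin N → EuclideanSpace ℝ (Fin 3)), (∀ N, Literature.MathematicalPhysics.StatisticalMechanics.IsGroundState Literature.MathematicalPhysics.StatisticalMechanics.lennardJones (x N)) → ∀ Y : Set (EuclideanSpace ℝ (Fin 3)), (0 : EuclideanSpace ℝ (Fin 3)) ∈ Y → (∀ R ε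 : ℝ, 0 < ε → ∃ L : ℝ, ∀ p ∈ Y, ∀ q ∈ Y, ∃ q' ∈ Y, dist q' q ≤ L ∧ (∀ y ∈ Y, dist y p ≤ R → ∃ y' ∈ Y, dist (y' - q') (y - p) ≤ ε) ∧ (∀ y' ∈ Y, dist y' q' ≤ R → ∃ y ∈ Y, dist (y' - q') (y - p) ≤ ε)) → (∃ (φ : ℕ → ℕ) (t : ℕ → EuclideanSpace ℝ (Fin 3)), StrictMono φ ∧ ∀ R ε : ℝ, 0 < ε → ∀ᶠ n in Filter.atTop, (∀ y ∈ Y, ‖y‖ ≤ R → ∃ i : Fin (φ n), dist (x (φ n) i + t n) y ≤ ε) ∧ (∀ i : Fin (φ n), ‖x (φ n) i + t n‖ ≤ R → ∃ y ∈ Y, dist (x (φ n) i + t n) y ≤ ε)) → Literature.MathematicalPhysics.StatisticalMechanics.UniformlyDiscrete Y → Literature.MathematicalPhysics.StatisticalMechanics.IsMuGSC Literature.MathematicalPhysics.StatisticalMechanics.lennardJones e Y → (¬ (∃ a : ℝ, 47 / 50 ≤ a ∧ a ≤ 1 ∧ ∀ y ∈ Y, ({w ∈ Y | w ≠ y ∧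 dist y w ≤ a * (1 + 1 / 50)}.ncard = 12 ∧ ∀ w ∈ Y, w ≠ y → a * (1 - 1 / 50) ≤ dist y w ∧ (dist y w ≤ a * (1 + 1 / 50) ∨ a * (63 / 50) ≤ dist y w)))) → (∀ z : EuclideanSpace ℝ (Fin 3), ∃ w ∈ Y, dist z w < 9 / 10) → (¬ (∃ W : Literature.MathematicalPhysics.StatisticalMechanics.PeriodicConfiguration 3, W.points = Y)) → (∃ ℓ₀ : ℝ, ∀ ℓ : ℝ, ∀ c : EuclideanSpace ℝ (Fin 3), ℓ₀ ≤ ℓ → ((Y ∩ {z | ∀ i : Fin 3, c i ≤ z i ∧ z i < c i + ℓ}).ncard : ℝ) < 2 * ℓ ^ 3) → (∃ ℓ₀ : ℝ, ∀ ℓ : ℝ, ∀ c : EuclideanSpace ℝ (Fin 3), ℓ₀ ≤ ℓ → 5 / 4 * ℓ ^ 3 < ((Y ∩ {z | ∀ i : Fin 3, c i ≤ z i ∧ z i < c i + ℓ}).ncard : ℝ)) → (∃ a : ℝ, 47 / 50 ≤ a ∧ a ≤ 1 ∧ ∃ K : ℝ, 0 < K ∧ ∃ c : EuclideanSpace ℝ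 (Fin 3), (∃ y ∈ Y, dist y c ≤ K ∧ ¬ (({v ∈ Y | v ≠ y ∧ dist y v ≤ a * (1 + 1 / 10)}.ncard = 12 ∧ ∀ v ∈ Y, v ≠ y → a * (1 - 1 / 10) ≤ dist y v ∧ (dist y v ≤ a * (1 + 1 / 10) ∨ a * (63 / 50) ≤ dist y v)) ∧ (∃ T : Finset (EuclideanSpace ℝ (Fin 3)), (↑T : Set (EuclideanSpace ℝ (Fin 3))) = (fun v => a⁻¹ • (v - y)) '' {v ∈ Y | v ≠ y ∧ dist y v ≤ a * (1 + 1 / 10)} ∧ (Literature.Geometry.DiscreteGeometry.ShellCloseTo (2 / 5) T Literature.Geometry.DiscreteGeometry.fccKissingPattern ∨ Literature.Geometry.DiscreteGeometry.ShellCloseTo (2 / 5) T Literature.Geometry.DiscreteGeometry.hcpKissingPattern)))) ∧ (∀ w ∈ Y, K < dist w c → dist w c ≤ 4 * K + 6 → (({v ∈ Y | v ≠ w ∧ dist w v ≤ a * (1 + 1 / 50)}.ncard = 12 ∧ ∀ v ∈ Y, v ≠ w → a * (1 - 1 / 50) ≤ dist w v ∧ (dist w v ≤ a * (1 + 1 /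 50) ∨ a * (63 / 50) ≤ dist w v)) ∧ (∃ T : Finset (EuclideanSpace ℝ (Fin 3)), (↑T : Set (EuclideanSpace ℝ (Fin 3))) = (fun v => a⁻¹ • (v - w)) '' {v ∈ Y | v ≠ w ∧ dist w v ≤ a * (1 + 1 / 50)} ∧ (Literature.Geometry.DiscreteGeometry.ShellCloseTo (1 / 5) T Literature.Geometry.DiscreteGeometry.fccKissingPattern ∨ Literature.Geometry.DiscreteGeometry.ShellCloseTo (1 / 5) T Literature.Geometry.DiscreteGeometry.hcpKissingPattern))))) → ∃ W : Literature.MathematicalPhysics.StatisticalMechanics.PeriodicConfiguration 3, ∀ R ε : ℝ, 0 < ε → ∃ᶠ N in Filter.atTop, ∃ t : EuclideanSpace ℝ (Fin 3), (∀ s ∈ W.points, ‖s‖ ≤ R → ∃ i : Fin N, dist (x N i + t) s ≤ ε) ∧ (∀ i : Fin N, ‖x N i + t‖ ≤ R → ∃ s ∈ W.points, dist (x N i + t) s ≤ ε)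

/-- item stmt-AtomisticToContinuum-28349 · crux · rank 3 · open · by planner
why it might fail: an aperiodic, recurrent, solid, isochoric configuration μ-stable at e* whose defects are all extended — an aperiodic screened dislocation/GB network or aperiodic tetrahedrally-close-packed bulk of energy density exactly e*: then U is the conjecture on that sequence.
sources: arXiv:1306.5334, arXiv:1608.06155, paper:arxiv-2207.01526, FlatleyTheil2015, Theil2006, BlancLewin2015
[crux] D⁰'s hypotheses plus ¬ISO(Y): at every scale a ∈ [47/50,1], for every loose-defective site y
(not Clean(1/10,2/5;a)) and every radius K > 0, the collar of sites at distance in (K, 4K+6] from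
any centre c with dist(y,c) ≤ K contains a site that is not Clean(1/50,1/5;a) — every defect is
ACCOMPANIED AT EVERY SCALE, i.e. the defect set of Y is extended (syndetic line / wall networks in a
charted matrix, or uncharted defective bulk) ⟹ x has periodic windows. DECLARED RESIDUAL of the node
(«unavoidable = extended defects at coexistence»). [deps: RecurrentMuStableLimit] [difficulty: XL] -/
@[route_item "route-AtomisticToContinuum-CompactDefectReducibility", crux]
def AccompaniedDefectLimitWindows : Prop :=
  ∀ e : ℝ, Filter.Tendsto (fun N : ℕ => Literature.MathematicalPhysics.StatisticalMechanics.groundStateEnergy Literature.MathematicalPhysics.StatisticalMechanics.lennardJones 3 N / N) Filter.atTop (nhds e) → (∀ N : ℕ, 0 < N → e ≤ Literature.MathematicalPhysics.StatisticalMechanics.groundStateEnergy Literature.MathematicalPhysics.StatisticalMechanics.lennardJones 3 N / N) → ∀ x : (N : ℕ) → (Fin N → EuclideanSpace ℝ (Fin 3)), (∀ N, Literature.MathematicalPhysics.StatisticalMechanics.IsGroundState Literature.MathematicalPhysics.StatisticalMechanics.lennardJones (x N)) → ∀ Y : Set (EuclideanSpace ℝ (Fin 3)), (0 : EuclideanSpace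 ℝ (Fin 3)) ∈ Y → (∀ R ε : ℝ, 0 < ε → ∃ L : ℝ, ∀ p ∈ Y, ∀ q ∈ Y, ∃ q' ∈ Y, dist q' q ≤ L ∧ (∀ y ∈ Y, dist y p ≤ R → ∃ y' ∈ Y, dist (y' - q') (y - p) ≤ ε) ∧ (∀ y' ∈ Y, dist y' q' ≤ R → ∃ y ∈ Y, dist (y' - q') (y - p) ≤ ε)) → (∃ (φ : ℕ → ℕ) (t : ℕ → EuclideanSpace ℝ (Fin 3)), StrictMono φ ∧ ∀ R ε : ℝ, 0 < ε → ∀ᶠ n in Filter.atTop, (∀ y ∈ Y, ‖y‖ ≤ R → ∃ i : Fin (φ n), dist (x (φ n) i + t n) y ≤ ε) ∧ (∀ i : Fin (φ n), ‖x (φ n) i + t n‖ ≤ R → ∃ y ∈ Y, dist (x (φ n) i + t n) y ≤ ε)) → Literature.MathematicalPhysics.StatisticalMechanics.UniformlyDiscrete Y → Literature.MathematicalPhysics.StatisticalMechanics.IsMuGSC Literature.MathematicalPhysics.StatisticalMechanics.lennardJones e Y → (¬ (∃ a : ℝ, 47 / 50 ≤ a ∧ a ≤ 1 ∧ ∀ y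 ∈ Y, ({w ∈ Y | w ≠ y ∧ dist y w ≤ a * (1 + 1 / 50)}.ncard = 12 ∧ ∀ w ∈ Y, w ≠ y → a * (1 - 1 / 50) ≤ dist y w ∧ (dist y w ≤ a * (1 + 1 / 50) ∨ a * (63 / 50) ≤ dist y w)))) → (∀ z : EuclideanSpace ℝ (Fin 3), ∃ w ∈ Y, dist z w < 9 / 10) → (¬ (∃ W : Literature.MathematicalPhysics.StatisticalMechanics.PeriodicConfiguration 3, W.points = Y)) → (∃ ℓ₀ : ℝ, ∀ ℓ : ℝ, ∀ c : EuclideanSpace ℝ (Fin 3), ℓ₀ ≤ ℓ → ((Y ∩ {z | ∀ i : Fin 3, c i ≤ z i ∧ z i < c i + ℓ}).ncard : ℝ) < 2 * ℓ ^ 3) → (∃ ℓ₀ : ℝ, ∀ ℓ : ℝ, ∀ c : EuclideanSpace ℝ (Fin 3), ℓ₀ ≤ ℓ → 5 / 4 * ℓ ^ 3 < ((Y ∩ {z | ∀ i : Fin 3, c i ≤ z i ∧ z i < c i + ℓ}).ncard : ℝ)) → (¬ (∃ a : ℝ, 47 / 50 ≤ a ∧ a ≤ 1 ∧ ∃ K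 : ℝ, 0 < K ∧ ∃ c : EuclideanSpace ℝ (Fin 3), (∃ y ∈ Y, dist y c ≤ K ∧ ¬ (({v ∈ Y | v ≠ y ∧ dist y v ≤ a * (1 + 1 / 10)}.ncard = 12 ∧ ∀ v ∈ Y, v ≠ y → a * (1 - 1 / 10) ≤ dist y v ∧ (dist y v ≤ a * (1 + 1 / 10) ∨ a * (63 / 50) ≤ dist y v)) ∧ (∃ T : Finset (EuclideanSpace ℝ (Fin 3)), (↑T : Set (EuclideanSpace ℝ (Fin 3))) = (fun v => a⁻¹ • (v - y)) '' {v ∈ Y | v ≠ y ∧ dist y v ≤ a * (1 + 1 / 10)} ∧ (Literature.Geometry.DiscreteGeometry.ShellCloseTo (2 / 5) T Literature.Geometry.DiscreteGeometry.fccKissingPattern ∨ Literature.Geometry.DiscreteGeometry.ShellCloseTo (2 / 5) T Literature.Geometry.DiscreteGeometry.hcpKissingPattern)))) ∧ (∀ w ∈ Y, K < dist w c → dist w c ≤ 4 * K + 6 → (({v ∈ Y | v ≠ w ∧ dist w v ≤ a * (1 + 1 / 50)}.ncard = 12 ∧ ∀ v ∈ Y, v ≠ w → a * (1 - 1 / 50)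 ≤ dist w v ∧ (dist w v ≤ a * (1 + 1 / 50) ∨ a * (63 / 50) ≤ dist w v)) ∧ (∃ T : Finset (EuclideanSpace ℝ (Fin 3)), (↑T : Set (EuclideanSpace ℝ (Fin 3))) = (fun v => a⁻¹ • (v - w)) '' {v ∈ Y | v ≠ w ∧ dist w v ≤ a * (1 + 1 / 50)} ∧ (Literature.Geometry.DiscreteGeometry.ShellCloseTo (1 / 5) T Literature.Geometry.DiscreteGeometry.fccKissingPattern ∨ Literature.Geometry.DiscreteGeometry.ShellCloseTo (1 / 5) T Literature.Geometry.DiscreteGeometry.hcpKissingPattern)))))) → ∃ W : Literature.MathematicalPhysics.StatisticalMechanics.PeriodicConfiguration 3, ∀ R ε : ℝ, 0 < ε → ∃ᶠ N in Filter.atTop, ∃ t : EuclideanSpace ℝ (Fin 3), (∀ s ∈ W.points, ‖s‖ ≤ R → ∃ i : Fin N, dist (x N i + t) s ≤ ε) ∧ (∀ i : Fin N, ‖x N i + t‖ ≤ R → ∃ s ∈ W.points, dist (x N i + t) s ≤ ε)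

/-- item stmt-AtomisticToContinuum-27258 · crux · rank 4 · open · by planner
why it might fail: only technically: no two-point certificate f ≤ V_LJ, f̂ ≥ 0 with (2·f̂(0) − f(0))/2 > −0.7175 may exist if the 3D LP duality gap for the r⁻¹² core at density 2 exceeds the +0.4 physical excess (Li 2022-type gap).
sources: arXiv:1902.05438, arXiv:1603.05202, arXiv:2206.09876, arXiv:math-ph/0508004, BlancLewin2015, stmt-AtomisticToContinuum-26046
[crux] P2's hypotheses plus OVERDENSE (for every ℓ₀ some half-open cube of side ℓ ≥ ℓ₀ with lower
corner c holds at least 2ℓ³ points of Y, i.e. ≥ 1.30 ρ_hcp) ⟹ x has periodic windows. Attack: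
periodise a dense cube, Cohn–Kumar LP with density term vs zero-slack μ-removal pinning and
certified e(hcp); elementary Kepler/Kossel fallback from density ≈ 3. [deps: RecurrentMuStableLimit]
[difficulty: M] -/
@[route_item "route-AtomisticToContinuum-CompactDefectReducibility", crux]
def OverdenseDefectLimitWindows : Prop :=
  ∀ e : ℝ, Filter.Tendsto (fun N : ℕ => Literature.MathematicalPhysics.StatisticalMechanics.groundStateEnergy Literature.MathematicalPhysics.StatisticalMechanics.lennardJones 3 N / N) Filter.atTop (nhds e) → (∀ N : ℕ, 0 < N → e ≤ Literature.MathematicalPhysics.StatisticalMechanics.groundStateEnergy Literature.MathematicalPhysics.StatisticalMechanics.lennardJones 3 N / N) → ∀ x : (N : ℕ) → (Fin N → EuclideanSpace ℝ (Fin 3)), (∀ N, Literature.MathematicalPhysics.StatisticalMechanics.IsGroundState Literature.MathematicalPhysics.StatisticalMechanics.lennardJones (x N)) → ∀ Y : Set (EuclideanSpace ℝ (Fin 3)), (0 : EuclideanSpace ℝ (Fin 3)) ∈ Y → (∀ R ε : ℝ, 0 < ε → ∃ L : ℝ, ∀ p ∈ Y, ∀ q ∈ Y, ∃ q' ∈ Y,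 dist q' q ≤ L ∧ (∀ y ∈ Y, dist y p ≤ R → ∃ y' ∈ Y, dist (y' - q') (y - p) ≤ ε) ∧ (∀ y' ∈ Y, dist y' q' ≤ R → ∃ y ∈ Y, dist (y' - q') (y - p) ≤ ε)) → (∃ (φ : ℕ → ℕ) (t : ℕ → EuclideanSpace ℝ (Fin 3)), StrictMono φ ∧ ∀ R ε : ℝ, 0 < ε → ∀ᶠ n in Filter.atTop, (∀ y ∈ Y, ‖y‖ ≤ R → ∃ i : Fin (φ n), dist (x (φ n) i + t n) y ≤ ε) ∧ (∀ i : Fin (φ n), ‖x (φ n) i + t n‖ ≤ R → ∃ y ∈ Y, dist (x (φ n) i + t n) y ≤ ε)) → Literature.MathematicalPhysics.StatisticalMechanics.UniformlyDiscrete Y → Literature.MathematicalPhysics.StatisticalMechanics.IsMuGSC Literature.MathematicalPhysics.StatisticalMechanics.lennardJones e Y → (¬ (∃ a : ℝ, 47 / 50 ≤ a ∧ a ≤ 1 ∧ ∀ y ∈ Y, ({w ∈ Y | w ≠ y ∧ dist y w ≤ a * (1 + 1 / 50)}.ncard = 12 ∧ ∀ w ∈ Y, w ≠ y → a * (1 -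 1 / 50) ≤ dist y w ∧ (dist y w ≤ a * (1 + 1 / 50) ∨ a * (63 / 50) ≤ dist y w)))) → (∀ z : EuclideanSpace ℝ (Fin 3), ∃ w ∈ Y, dist z w < 9 / 10) → (∀ ℓ₀ : ℝ, ∃ ℓ : ℝ, ∃ c : EuclideanSpace ℝ (Fin 3), ℓ₀ ≤ ℓ ∧ 2 * ℓ ^ 3 ≤ ((Y ∩ {z | ∀ i : Fin 3, c i ≤ z i ∧ z i < c i + ℓ}).ncard : ℝ)) → ∃ W : Literature.MathematicalPhysics.StatisticalMechanics.PeriodicConfiguration 3, ∀ R ε : ℝ, 0 < ε → ∃ᶠ N in Filter.atTop, ∃ t : EuclideanSpace ℝ (Fin 3), (∀ s ∈ W.points, ‖s‖ ≤ R → ∃ i : Fin N, dist (x N i + t) s ≤ ε) ∧ (∀ i : Fin N, ‖x N i + t‖ ≤ R → ∃ s ∈ W.points, dist (x N i + t) s ≤ ε)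

/-- item stmt-AtomisticToContinuum-27259 · crux · rank 5 · open · by planner
why it might fail: it cannot be false without Crystallization failing; it may resist because no Flyspeck-type local inequality turns fat Voronoi cells of a soft-potential configuration into a certified per-site energy deficit.
sources: Hales2005, Theil2006, BlancLewin2015, arXiv:1902.05438, stmt-AtomisticToContinuum-26046, stmt-AtomisticToContinuum-25861
[crux] P2's hypotheses plus UNDERDENSE (for every ℓ₀ some half-open cube of side ℓ ≥ ℓ₀ holds at
most (5/4)ℓ³ points of Y, i.e. ≤ 0.81 ρ_hcp) ⟹ x has periodic windows. Content: a solid (covering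
radius < 9/10) but dilute μ-stable network at e* — Voronoi cells ⊂ B(y, 9/10), mean cell volume ≥
4/5 vs 0.648 for hcp; missing: density → first-shell-deficit transfer, then the coordination-capped
LP floor(11) = e_hcp + 0.0087. [deps: RecurrentMuStableLimit] [difficulty: L] -/
@[route_item "route-AtomisticToContinuum-CompactDefectReducibility", crux]
def UnderdenseDefectLimitWindows : Prop :=
  ∀ e : ℝ, Filter.Tendsto (fun N : ℕ => Literature.MathematicalPhysics.StatisticalMechanics.groundStateEnergy Literature.MathematicalPhysics.StatisticalMechanics.lennardJones 3 N / N) Filter.atTop (nhds e) → (∀ N : ℕ, 0 < N → e ≤ Literature.MathematicalPhysics.StatisticalMechanics.groundStateEnergy Literature.MathematicalPhysics.StatisticalMechanics.lennardJones 3 N / N) → ∀ x : (N : ℕ) → (Fin N → EuclideanSpace ℝ (Fin 3)), (∀ N, Literature.MathematicalPhysics.StatisticalMechanics.IsGroundState Literature.MathematicalPhysics.StatisticalMechanics.lennardJones (x N)) → ∀ Y : Set (EuclideanSpace ℝ (Fin 3)), (0 : EuclideanSpace ℝ (Fin 3)) ∈ Y → (∀ R ε : ℝ, 0 < ε → ∃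 L : ℝ, ∀ p ∈ Y, ∀ q ∈ Y, ∃ q' ∈ Y, dist q' q ≤ L ∧ (∀ y ∈ Y, dist y p ≤ R → ∃ y' ∈ Y, dist (y' - q') (y - p) ≤ ε) ∧ (∀ y' ∈ Y, dist y' q' ≤ R → ∃ y ∈ Y, dist (y' - q') (y - p) ≤ ε)) → (∃ (φ : ℕ → ℕ) (t : ℕ → EuclideanSpace ℝ (Fin 3)), StrictMono φ ∧ ∀ R ε : ℝ, 0 < ε → ∀ᶠ n in Filter.atTop, (∀ y ∈ Y, ‖y‖ ≤ R → ∃ i : Fin (φ n), dist (x (φ n) i + t n) y ≤ ε) ∧ (∀ i : Fin (φ n), ‖x (φ n) i + t n‖ ≤ R → ∃ y ∈ Y, dist (x (φ n) i + t n) y ≤ ε)) → Literature.MathematicalPhysics.StatisticalMechanics.UniformlyDiscrete Y → Literature.MathematicalPhysics.StatisticalMechanics.IsMuGSC Literature.MathematicalPhysics.StatisticalMechanics.lennardJones e Y → (¬ (∃ a : ℝ, 47 / 50 ≤ a ∧ a ≤ 1 ∧ ∀ y ∈ Y, ({w ∈ Y | w ≠ y ∧ dist y w ≤ a * (1 + 1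 / 50)}.ncard = 12 ∧ ∀ w ∈ Y, w ≠ y → a * (1 - 1 / 50) ≤ dist y w ∧ (dist y w ≤ a * (1 + 1 / 50) ∨ a * (63 / 50) ≤ dist y w)))) → (∀ z : EuclideanSpace ℝ (Fin 3), ∃ w ∈ Y, dist z w < 9 / 10) → (∀ ℓ₀ : ℝ, ∃ ℓ : ℝ, ∃ c : EuclideanSpace ℝ (Fin 3), ℓ₀ ≤ ℓ ∧ ((Y ∩ {z | ∀ i : Fin 3, c i ≤ z i ∧ z i < c i + ℓ}).ncard : ℝ) ≤ 5 / 4 * ℓ ^ 3) → ∃ W : Literature.MathematicalPhysics.StatisticalMechanics.PeriodicConfiguration 3, ∀ R ε : ℝ, 0 < ε → ∃ᶠ N in Filter.atTop, ∃ t : EuclideanSpace ℝ (Fin 3), (∀ s ∈ W.points, ‖s‖ ≤ R → ∃ i : Fin N, dist (x N i + t) s ≤ ε) ∧ (∀ i : Fin N, ‖x N i + t‖ ≤ R → ∃ s ∈ W.points, dist (x N i + t) s ≤ ε)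

/-- item stmt-AtomisticToContinuum-26047 · crux · rank 6 · open · by planner
why it might fail: a recurrent μ-stable LJ sponge with energy density exactly e*: loose pores of radius in (1, 3/2) pass the one-point insertion test; excluding syndetic loose pores needs positive 3D surface tension (open).
sources: arXiv:math-ph/0508004, HeitmannRadin1980, Theil2006, BlancLewin2015, stmt-AtomisticToContinuum-24040, stmt-AtomisticToContinuum-24667
[crux] same normal form as rank 2 but POROUS (some point z of space with no point of Y within <
9/10, i.e. room for an extra particle): x has periodic windows. Content: cohesion / no-foam for
μ-stable e*-matter with syndetic pores; vacancy-type pores are excluded now by the Kossel sandwich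
u(w|Y) ≤ e ≤ I(z|Y). [deps: RecurrentMuStableLimit] [difficulty: L] -/
@[route_item "route-AtomisticToContinuum-CompactDefectReducibility", crux]
def PorousDefectLimitWindows : Prop :=
  ∀ e : ℝ, Filter.Tendsto (fun N : ℕ => Literature.MathematicalPhysics.StatisticalMechanics.groundStateEnergy Literature.MathematicalPhysics.StatisticalMechanics.lennardJones 3 N / N) Filter.atTop (nhds e) → (∀ N : ℕ, 0 < N → e ≤ Literature.MathematicalPhysics.StatisticalMechanics.groundStateEnergy Literature.MathematicalPhysics.StatisticalMechanics.lennardJones 3 N / N) → ∀ x : (N : ℕ) → (Fin N → EuclideanSpace ℝ (Fin 3)), (∀ N, Literature.MathematicalPhysics.StatisticalMechanics.IsGroundState Literature.MathematicalPhysics.StatisticalMechanics.lennardJones (x N)) → ∀ Y : Set (EuclideanSpace ℝ (Fin 3)), (0 : EuclideanSpace ℝ (Fin 3)) ∈ Y → (∀ R ε : ℝ, 0 < ε → ∃ L : ℝ, ∀ p ∈ Y, ∀ q ∈ Y, ∃ q' ∈ Y, dist q' q ≤ L ∧ (∀ y ∈ Y, dist y p ≤ R → ∃ y' ∈ Y,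 dist (y' - q') (y - p) ≤ ε) ∧ (∀ y' ∈ Y, dist y' q' ≤ R → ∃ y ∈ Y, dist (y' - q') (y - p) ≤ ε)) → (∃ (φ : ℕ → ℕ) (t : ℕ → EuclideanSpace ℝ (Fin 3)), StrictMono φ ∧ ∀ R ε : ℝ, 0 < ε → ∀ᶠ n in Filter.atTop, (∀ y ∈ Y, ‖y‖ ≤ R → ∃ i : Fin (φ n), dist (x (φ n) i + t n) y ≤ ε) ∧ (∀ i : Fin (φ n), ‖x (φ n) i + t n‖ ≤ R → ∃ y ∈ Y, dist (x (φ n) i + t n) y ≤ ε)) → Literature.MathematicalPhysics.StatisticalMechanics.UniformlyDiscrete Y → Literature.MathematicalPhysics.StatisticalMechanics.IsMuGSC Literature.MathematicalPhysics.StatisticalMechanics.lennardJones e Y → (¬ (∃ a : ℝ, 47 / 50 ≤ a ∧ a ≤ 1 ∧ ∀ y ∈ Y, ({w ∈ Y | w ≠ y ∧ dist y w ≤ a * (1 + 1 / 50)}.ncard = 12 ∧ ∀ w ∈ Y, w ≠ y → a * (1 - 1 / 50) ≤ dist y w ∧ (dist y w ≤ a * (1 + 1 / 50) ∨ a * (63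 / 50) ≤ dist y w)))) → (∃ z : EuclideanSpace ℝ (Fin 3), ∀ w ∈ Y, 9 / 10 ≤ dist z w) → ∃ W : Literature.MathematicalPhysics.StatisticalMechanics.PeriodicConfiguration 3, ∀ R ε : ℝ, 0 < ε → ∃ᶠ N in Filter.atTop, ∃ t : EuclideanSpace ℝ (Fin 3), (∀ s ∈ W.points, ‖s‖ ≤ R → ∃ i : Fin N, dist (x N i + t) s ≤ ε) ∧ (∀ i : Fin N, ‖x N i + t‖ ≤ R → ∃ s ∈ W.points, dist (x N i + t) s ≤ ε)

/-- item stmt-AtomisticToContinuum-24668 · crux · rank 7 · open · by planner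
why it might fail: residual in-layer strain no translate-limit removes because layered coercivity fails for some relaxed polytype (soft shear branch), or non-parallel twin junctions compatible with all-clean shells at tolerance 1/5.
sources: Hales2012, FlatleyTheil2015, BlancLewin2015, stmt-AtomisticToContinuum-15932, stmt-AtomisticToContinuum-11779
[crux] for every sequence x of LJ ground states and every recurrent local limit Y ∋ 0 of x, if at
some scale a ∈ [47/50,1] every site is gapped-twelve with bond shell 1/5-close to fcc or hcp, then x
has periodic windows (= GappedShellCensus.CleanLimitsHaveWindows stmt-15932 with recurrence added).
[deps: RecurrentLocalLimit] [difficulty: L] -/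
@[route_item "route-AtomisticToContinuum-CompactDefectReducibility", crux]
def CleanRecurrentLimitWindows : Prop :=
  ∀ x : (N : ℕ) → (Fin N → EuclideanSpace ℝ (Fin 3)), (∀ N, Literature.MathematicalPhysics.StatisticalMechanics.IsGroundState Literature.MathematicalPhysics.StatisticalMechanics.lennardJones (x N)) → ∀ Y : Set (EuclideanSpace ℝ (Fin 3)), (0 : EuclideanSpace ℝ (Fin 3)) ∈ Y → (∀ R ε : ℝ, 0 < ε → ∃ L : ℝ, ∀ p ∈ Y, ∀ q ∈ Y, ∃ q' ∈ Y, dist q' q ≤ L ∧ (∀ y ∈ Y, dist y p ≤ R → ∃ y' ∈ Y, dist (y' - q') (y - p) ≤ ε) ∧ (∀ y' ∈ Y, dist y' q' ≤ R → ∃ y ∈ Y, dist (y' - q') (y - p) ≤ ε)) → (∃ (φ : ℕ → ℕ) (t : ℕ → EuclideanSpace ℝ (Fin 3)), StrictMono φ ∧ ∀ R ε : ℝ, 0 < ε → ∀ᶠ n in Filter.atTop, (∀ y ∈ Y, ‖y‖ ≤ R → ∃ i : Fin (φ n), dist (x (φ n) i + t n) y ≤ ε) ∧ (∀ i : Fin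 (φ n), ‖x (φ n) i + t n‖ ≤ R → ∃ y ∈ Y, dist (x (φ n) i + t n) y ≤ ε)) → (∃ a : ℝ, 47 / 50 ≤ a ∧ a ≤ 1 ∧ ∀ y ∈ Y, ({w ∈ Y | w ≠ y ∧ dist y w ≤ a * (1 + 1 / 50)}.ncard = 12 ∧ ∀ w ∈ Y, w ≠ y → a * (1 - 1 / 50) ≤ dist y w ∧ (dist y w ≤ a * (1 + 1 / 50) ∨ a * (63 / 50) ≤ dist y w)) ∧ (∃ T : Finset (EuclideanSpace ℝ (Fin 3)), (↑T : Set (EuclideanSpace ℝ (Fin 3))) = (fun w => a⁻¹ • (w - y)) '' {w ∈ Y | w ≠ y ∧ dist y w ≤ a * (1 + 1 / 50)} ∧ (Literature.Geometry.DiscreteGeometry.ShellCloseTo (1 / 5) T Literature.Geometry.DiscreteGeometry.fccKissingPattern ∨ Literature.Geometry.DiscreteGeometry.ShellCloseTo (1 / 5) T Literature.Geometry.DiscreteGeometry.hcpKissingPattern))) → ∃ W : Literature.MathematicalPhysics.StatisticalMechanics.PeriodicConfiguration 3, ∀ R ε : ℝ, 0 < ε → ∃ᶠ N in Filter.atTop,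 ∃ t : EuclideanSpace ℝ (Fin 3), (∀ s ∈ W.points, ‖s‖ ≤ R → ∃ i : Fin N, dist (x N i + t) s ≤ ε) ∧ (∀ i : Fin N, ‖x N i + t‖ ≤ R → ∃ s ∈ W.points, dist (x N i + t) s ≤ ε)

/-- item stmt-AtomisticToContinuum-24669 · crux · rank 8 · open · by planner
why it might fail: an all-gapped-twelve recurrent TORN crystal (torn icosahedral / bicuboctahedral shells sharing voids) with energy density e*: S stays true but its geometric attack dies.
sources: FlatleyTheil2015, Hales2012, BoroczkySzabo2015, stmt-AtomisticToContinuum-18069, stmt-AtomisticToContinuum-18071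
[crux] for every sequence x of LJ ground states and every recurrent local limit Y ∋ 0 of x, if at
some scale a ∈ [47/50,1] every site is gapped-twelve but at no scale are all shells fcc/hcp-close,
then x has periodic windows (attack: ShellTrichotomy 18070 + TornFree 18069 + recurrence ⇒ R-dense
five-fold axes, forbidden by FiveFoldRationingR 18071). [deps: RecurrentLocalLimit] [difficulty: L] -/
@[route_item "route-AtomisticToContinuum-CompactDefectReducibility", crux]
def TornCappedRecurrentLimitWindows : Prop :=
  ∀ x : (N : ℕ) → (Fin N → EuclideanSpace ℝ (Fin 3)), (∀ N, Literature.MathematicalPhysics.StatisticalMechanics.IsGroundState Literature.MathematicalPhysics.StatisticalMechanics.lennardJones (x N)) → ∀ Y : Set (EuclideanSpace ℝ (Fin 3)), (0 : EuclideanSpace ℝ (Fin 3)) ∈ Y → (∀ R ε : ℝ, 0 < ε → ∃ L : ℝ, ∀ p ∈ Y, ∀ q ∈ Y, ∃ q' ∈ Y, dist q' q ≤ L ∧ (∀ y ∈ Y, dist y p ≤ R → ∃ y' ∈ Y, dist (y' - q') (y - p) ≤ ε) ∧ (∀ y' ∈ Y, dist y' q' ≤ R → ∃ y ∈ Y, dist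 (y' - q') (y - p) ≤ ε)) → (∃ (φ : ℕ → ℕ) (t : ℕ → EuclideanSpace ℝ (Fin 3)), StrictMono φ ∧ ∀ R ε : ℝ, 0 < ε → ∀ᶠ n in Filter.atTop, (∀ y ∈ Y, ‖y‖ ≤ R → ∃ i : Fin (φ n), dist (x (φ n) i + t n) y ≤ ε) ∧ (∀ i : Fin (φ n), ‖x (φ n) i + t n‖ ≤ R → ∃ y ∈ Y, dist (x (φ n) i + t n) y ≤ ε)) → (∃ a : ℝ, 47 / 50 ≤ a ∧ a ≤ 1 ∧ ∀ y ∈ Y, ({w ∈ Y | w ≠ y ∧ dist y w ≤ a * (1 + 1 / 50)}.ncard = 12 ∧ ∀ w ∈ Y, w ≠ y → a * (1 - 1 / 50) ≤ dist y w ∧ (dist y w ≤ a * (1 + 1 / 50) ∨ a * (63 / 50) ≤ dist y w))) → (¬ (∃ a : ℝ, 47 / 50 ≤ a ∧ a ≤ 1 ∧ ∀ y ∈ Y, ({w ∈ Y | w ≠ y ∧ dist y w ≤ a * (1 + 1 / 50)}.ncard = 12 ∧ ∀ w ∈ Y, w ≠ y → a * (1 - 1 / 50) ≤ dist y w ∧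 (dist y w ≤ a * (1 + 1 / 50) ∨ a * (63 / 50) ≤ dist y w)) ∧ (∃ T : Finset (EuclideanSpace ℝ (Fin 3)), (↑T : Set (EuclideanSpace ℝ (Fin 3))) = (fun w => a⁻¹ • (w - y)) '' {w ∈ Y | w ≠ y ∧ dist y w ≤ a * (1 + 1 / 50)} ∧ (Literature.Geometry.DiscreteGeometry.ShellCloseTo (1 / 5) T Literature.Geometry.DiscreteGeometry.fccKissingPattern ∨ Literature.Geometry.DiscreteGeometry.ShellCloseTo (1 / 5) T Literature.Geometry.DiscreteGeometry.hcpKissingPattern)))) → ∃ W : Literature.MathematicalPhysics.StatisticalMechanics.PeriodicConfiguration 3, ∀ R ε : ℝ, 0 < ε → ∃ᶠ N in Filter.atTop, ∃ t : EuclideanSpace ℝ (Fin 3), (∀ s ∈ W.points, ‖s‖ ≤ R → ∃ i : Fin N, dist (x N i + t) s ≤ ε) ∧ (∀ i : Fin N, ‖x N i + t‖ ≤ R → ∃ s ∈ W.points, dist (x N i + t) s ≤ ε)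

/-- item stmt-AtomisticToContinuum-26048 · support · rank 9 · open · by planner
sources: arXiv:math-ph/0508004, BlancLewin2015, stmt-AtomisticToContinuum-13684, stmt-AtomisticToContinuum-13685
[support] for every e with E(N)/N → e and e ≤ E(N)/N (the coexistence potential,
`BlancLewin2015_8_holds`), every sequence of LJ ground states has a local limit Y ∋ 0 (two-way
ε-matched on B(0,R) by translates of a subsequence, eventually), uniformly recurrent along
particles, uniformly discrete and a μGSC of lennardJones at μ = e. Route: SelectedGrandStability
(stmt-13684) → MuGSCLimitExtraction (stmt-13685) → minimal element of the pointed hull (μ-stability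
is closed under separated local limits). [difficulty: provable-now] -/
@[route_item "route-AtomisticToContinuum-CompactDefectReducibility", crux]
def RecurrentMuStableLimit : Prop :=
  ∀ e : ℝ, Filter.Tendsto (fun N : ℕ => Literature.MathematicalPhysics.StatisticalMechanics.groundStateEnergy Literature.MathematicalPhysics.StatisticalMechanics.lennardJones 3 N / N) Filter.atTop (nhds e) → (∀ N : ℕ, 0 < N → e ≤ Literature.MathematicalPhysics.StatisticalMechanics.groundStateEnergy Literature.MathematicalPhysics.StatisticalMechanics.lennardJones 3 N / N) → ∀ x : (N : ℕ) → (Fin N → EuclideanSpace ℝ (Fin 3)), (∀ N, Literature.MathematicalPhysics.StatisticalMechanics.IsGroundState Literature.MathematicalPhysics.StatisticalMechanics.lennardJones (x N)) → ∃ Y : Set (EuclideanSpace ℝ (Fin 3)), (0 : EuclideanSpace ℝ (Fin 3)) ∈ Y ∧ (∀ R ε : ℝ, 0 < ε → ∃ L : ℝ, ∀ p ∈ Y, ∀ q ∈ Y, ∃ q' ∈ Y, dist q' q ≤ L ∧ (∀ y ∈ Y, dist y p ≤ R → ∃ y' ∈ Y, dist (y' - q') (y - p) ≤ ε) ∧ (∀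 y' ∈ Y, dist y' q' ≤ R → ∃ y ∈ Y, dist (y' - q') (y - p) ≤ ε)) ∧ (∃ (φ : ℕ → ℕ) (t : ℕ → EuclideanSpace ℝ (Fin 3)), StrictMono φ ∧ ∀ R ε : ℝ, 0 < ε → ∀ᶠ n in Filter.atTop, (∀ y ∈ Y, ‖y‖ ≤ R → ∃ i : Fin (φ n), dist (x (φ n) i + t n) y ≤ ε) ∧ (∀ i : Fin (φ n), ‖x (φ n) i + t n‖ ≤ R → ∃ y ∈ Y, dist (x (φ n) i + t n) y ≤ ε)) ∧ Literature.MathematicalPhysics.StatisticalMechanics.UniformlyDiscrete Y ∧ Literature.MathematicalPhysics.StatisticalMechanics.IsMuGSC Literature.MathematicalPhysics.StatisticalMechanics.lennardJones e Y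

/-- item stmt-AtomisticToContinuum-28350 · assembly · rank 1 · open · by planner
sources: stmt-AtomisticToContinuum-27257, stmt-AtomisticToContinuum-3243, stmt-AtomisticToContinuum-11780
[assembly] RedMu → A → S → P1 → D⁺ → D⁻ → R → U → Crystallization -/
@[route_item "route-AtomisticToContinuum-CompactDefectReducibility"]
def Assembly : Prop :=
  RecurrentMuStableLimit → CleanRecurrentLimitWindows → TornCappedRecurrentLimitWindows → PorousDefectLimitWindows → OverdenseDefectLimitWindows → UnderdenseDefectLimitWindows → IsolatedDefectLimitWindows → AccompaniedDefectLimitWindows → _root_.Crystallization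

/-! D-0027 §2.1 — DECIDING THEOREM (planner-authored via `route open/edit --closes-file`; by planner-decomp-a2c-lens-4-g4-0 2026-08-30T05:10:55Z):
its hypotheses are this route's items and its conclusion the sub-problem Statement (glue_lint), and it elaborates with this file. -/

@[closes "route-AtomisticToContinuum-CompactDefectReducibility"] theorem closes (h_RecurrentMuStableLimit : RecurrentMuStableLimit) (h_CleanRecurrentLimitWindows : CleanRecurrentLimitWindows)
    (h_TornCappedRecurrentLimitWindows : TornCappedRecurrentLimitWindows)
    (h_PorousDefectLimitWindows : PorousDefectLimitWindows)
    (h_OverdenseDefectLimitWindows : OverdenseDefectLimitWindows)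
    (h_UnderdenseDefectLimitWindows : UnderdenseDefectLimitWindows)
    (h_IsolatedDefectLimitWindows : IsolatedDefectLimitWindows)
    (h_AccompaniedDefectLimitWindows : AccompaniedDefectLimitWindows) : _root_.Crystallization := by
  -- The parent node's landed deciding theorem (route CoexistenceDensityWindow, rev 0) takes RedMu, A, S, P1, D⁺, D⁻ (shared verbatim)
  -- and D⁰; D⁰ = IsochoricAperiodicDefectLimitWindows is assembled from the two new pieces by excluded middle on ISO(Y)
  -- (a loose defect compactly isolated inside a tight-clean proportional collar, at some scale and radius).
  refine _root_.Summit.AtomisticToContinuum.Crystallization.Theses.CoexistenceDensityWindow.closes h_RecurrentMuStableLimit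
    h_CleanRecurrentLimitWindows h_TornCappedRecurrentLimitWindows h_PorousDefectLimitWindows h_OverdenseDefectLimitWindows
    h_UnderdenseDefectLimitWindows ?_
  intro e hT hlb x hx Y h0 hrec hlim hUD hμ hgap hsolid haper hup hlow
  by_cases hiso : ∃ a : ℝ, 47 / 50 ≤ a ∧ a ≤ 1 ∧ ∃ K : ℝ, 0 < K ∧ ∃ c : EuclideanSpace ℝ (Fin 3), (∃ y ∈ Y, dist y c ≤ K ∧ ¬ (({v ∈ Y | v ≠ y ∧ dist y v ≤ a * (1 + 1 / 10)}.ncard = 12 ∧ ∀ v ∈ Y, v ≠ y → a * (1 - 1 / 10) ≤ dist y v ∧ (dist y v ≤ a * (1 + 1 / 10) ∨ a * (63 / 50) ≤ dist y v)) ∧ (∃ T : Finset (EuclideanSpace ℝ (Fin 3)), (↑T : Set (EuclideanSpace ℝ (Fin 3))) = (fun v => a⁻¹ • (v - y)) '' {v ∈ Y | v ≠ y ∧ dist y v ≤ a * (1 + 1 / 10)} ∧ (Literature.Geometry.DiscreteGeometry.ShellCloseTo (2 / 5) T Literature.Geometry.DiscreteGeometry.fccKissingPattern ∨ Literature.Geometry.DiscreteGeometry.ShellCloseTo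 (2 / 5) T Literature.Geometry.DiscreteGeometry.hcpKissingPattern)))) ∧ (∀ w ∈ Y, K < dist w c → dist w c ≤ 4 * K + 6 → (({v ∈ Y | v ≠ w ∧ dist w v ≤ a * (1 + 1 / 50)}.ncard = 12 ∧ ∀ v ∈ Y, v ≠ w → a * (1 - 1 / 50) ≤ dist w v ∧ (dist w v ≤ a * (1 + 1 / 50) ∨ a * (63 / 50) ≤ dist w v)) ∧ (∃ T : Finset (EuclideanSpace ℝ (Fin 3)), (↑T : Set (EuclideanSpace ℝ (Fin 3))) = (fun v => a⁻¹ • (v - w)) '' {v ∈ Y | v ≠ w ∧ dist w v ≤ a * (1 + 1 / 50)} ∧ (Literature.Geometry.DiscreteGeometry.ShellCloseTo (1 / 5) T Literature.Geometry.DiscreteGeometry.fccKissingPattern ∨ Literature.Geometry.DiscreteGeometry.ShellCloseTo (1 / 5) T Literature.Geometry.DiscreteGeometry.hcpKissingPattern))))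
  · exact h_IsolatedDefectLimitWindows e hT hlb x hx Y h0 hrec hlim hUD hμ hgap hsolid haper hup hlow hiso
  · exact h_AccompaniedDefectLimitWindows e hT hlb x hx Y h0 hrec hlim hUD hμ hgap hsolid haper hup hlow hiso

end Summit.AtomisticToContinuum.Crystallization.Theses.CompactDefectReducibility
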